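import Literature.MathematicalPhysics.QuantumFieldTheory.Balaban1983to89.Beta.ScalewiseVectorSeam
import Literature.MathematicalPhysics.QuantumFieldTheory.Balaban1983to89.Beta.PolarizationWitnessZd
import Literature.MathematicalPhysics.QuantumFieldTheory.Balaban1983to89.Beta.WallWitness

/-!
# Bałaban's lattice YM₄ RG programme — β-function sub-cell: NON-VACUITY OF THE EXIT-B SOCKET v2
# (lead lineage strat-b12, gen 10; RULINGS (R21)/(R22); companion of `Beta/WallWitness` for the scale-wise vector road)
# VERSIONS: v1 (this file; `stepBal_nonneg` reused from `Beta/WallWitness`, not restated).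

HONEST FRAMING (cell rule, verbatim): «discharging `BetaPertH` makes Bałaban's UV stability UNCONDITIONAL — a real constructive-QFT
result; it is NOT the continuum limit and NOT the Clay problem.»  This module DISCHARGES NOTHING of the wall and asserts nothing printed:
it is a [folklore] CERTIFICATE that the hypothesis list of the β sub-cell's EXIT-B socket v2
`ScalewiseVectorSeam.endpointExistence_of_scalewise_vectorSeam_printed_flip_cont` (RULINGS (R21)/(R22), BETA-SPEC §7.39 (d)) is JOINTLY
SATISFIABLE — relative to the two printed Props quoted BY NAME (`B5.Prop12Printed`, `B5.Kernel126_127Printed`, the (α)-leaves, which stay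
hypotheses) — by EXPLICIT scale-wise data whose one-step kernels have PRESCRIBED, in particular NON-ZERO, (1.22) moments.  After RULING (R21)
located that the printed p. 293 laws instantiated UNFLIPPED at a `hessKer`-type family would force β⁰ ≡ 0, this is the check that the
FLIPPED socket does not: the kernels below are multiples of the FLIP `z ↦ Π^ℤ(−z)` of pv09's explicit infinite-volume Maxwell kernel
(`PolarizationWitnessZd.maxwellKernelZ 4`: (5.7)/(5.9)/(5.10) hold, `secondMoment = 2`), so the socket's `hW♭`/`hR♭` are met by the
PRINT-convention laws of `Π^ℤ` itself while the kernels live in the `hessKer` orientation.  NOT summit progress.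

## What is proved ([folklore]; 0 cited facts)

* §1 kernel-family algebra: (5.10)/(5.9)/(5.7), `secondMoment` (1.22) and `m2Tensor` under scaling and finite sums (`decay510_smul`,
  `wardTransversal_smul`, `axisReflectionCovariant_smul`, `secondMoment_smul/_add/_sum/_flip`, `absMoment₂_add/_kernel_sum`, `m2Tensor_add/_sum`).
* §2 the witness over a parameter record `Cfg` (labels `SL`, channel `μ ≠ ν`, `N`, the B5/one-shot parameter `a`, `k`, block size `Lc`, and a
  FREE perturbation sequence `d`): `T j := coef j • K₀flip`, `coef j := (oneShotSide (Lc^(j+1)) − oneShotSide (Lc^j))/2 + d j`,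
  `𝒯 m := Σ_{j<m} T j`, `β⁰_j := secondMoment (T j) μ ν`, `β¹ := 0`, construction `FlowStepRuns.modelOf`.
* §3 EVERY binder of the socket at the witness: `hdec_w` ((5.10) per step), `hW_w`/`hR_w` ((5.9)/(5.7) OF THE FLIPPED kernels = of `coef j • Π^ℤ`),
  `hβ_w` (`rfl`), `htel_w` (`D1Tel`: `coarseTensor_minimiser` + `m2Tensor_sum`), `hrep_w` (`D1Rep` with `U := |oneShotSide … 1| + 2D` whenever
  `|Σ_{j<m} d j| ≤ D`), `hrem_w` ((D4) with `rr = 0`), `hcont_w` ((C)); NO upper-bound binder is needed ((R22)).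
* §4 `socket_v2_inhabited`: the socket APPLIED to the witness ⟹ `EndpointExistence (modelOf (betaW P))`; `step0_moment_free` / `spike_bounded`:
  the step-0 (1.22) moment equals the one-shot increment `+ 2·d 0` with `d 0` FREE (admissible `d := (δ, 0, 0, …)`, `D := |δ|`) — the socket
  does not pin `β⁰`, in particular not to `0`.

NB (located while building this file): the B5 averaging parameter `a` of the (α)-leaf `h12 : B5.Prop12Printed (fam … MvE a ha)` IS the `a`
of the one-shot side `oneShotSide SL μ ν N a k n` (`GfE a k n b`); a witness built on a different `a` does not type-check against the socket.

## READING CLAUSE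

Nothing here refers to Bałaban's kernels; `Π^ℤ` is pv09's explicit tree-level witness kernel, `2` its (1.22) moment, and the
one-shot side `oneShotSide` is the cell's own explicit `K^∞` full-sum functional.  Context only: [Balaban1987RG1] = T. Bałaban,
Commun. Math. Phys. 109 (1987) 249–301, (1.22) p. 264, (5.7)–(5.10) p. 293 (quoted in `B12Beta` / `Beta/PolarizationSign`, not re-quoted).
-/

noncomputable section

open Filter Topology Finset
open scoped BigOperators

namespace Literature.MathematicalPhysics.QuantumFieldTheory.Balaban1983to89.Beta.ScalewiseWitness

open Literature.MathematicalPhysics.QuantumFieldTheory.Balaban1983to89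
open FlowStep FlowStepRuns DagBinding
open Literature.MathematicalPhysics.QuantumFieldTheory.Balaban1983to89.B12Beta (secondMoment)
open Literature.MathematicalPhysics.QuantumFieldTheory.Balaban1983to89.Beta.VectorTailsLoc (fam kfam)
open Literature.MathematicalPhysics.QuantumFieldTheory.Balaban1983to89.Beta.RemainderChain (RemainderConst)
open Literature.MathematicalPhysics.QuantumFieldTheory.Balaban1983to89.Beta.DecimatedMomentSummable
  (AbsMoment₂ IsMoment₂ summable_smul_of_absMoment₂ absMoment₂_of_decay510)
open Literature.MathematicalPhysics.QuantumFieldTheory.Balaban1983to89.Beta.DressedMomentNormalisation (EKer coarseTensor m2Tensor)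
open Literature.MathematicalPhysics.QuantumFieldTheory.Balaban1983to89.Beta.HidentScalewise (Tensor4 HessianTelescoping)
open Literature.MathematicalPhysics.QuantumFieldTheory.Balaban1983to89.Beta.MinimiserIdentityForm (coarseTensor_minimiser)
open Literature.MathematicalPhysics.QuantumFieldTheory.Balaban1983to89.Beta.VectorLegVolumeAdapter (MvE)
open Literature.MathematicalPhysics.QuantumFieldTheory.Balaban1983to89.Beta.PolarizationSign
  (WardTransversal AxisReflectionCovariant MomentSummable)
open Literature.MathematicalPhysics.QuantumFieldTheory.Balaban1983to89.Beta.PolarizationWitnessZd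
  (maxwellKernelZ wardTransversal_maxwellKernelZ axisReflectionCovariant_maxwellKernelZ decay510_maxwellKernelZ secondMoment_maxwellKernelZ)
open Literature.MathematicalPhysics.QuantumFieldTheory.Balaban1983to89.Beta.ScalewiseVectorSeam
  (oneShotSide decay510_flip scalewiseData_of_printed_flip endpointExistence_of_scalewise_vectorSeam_printed_flip_cont)

variable {L : Type*}

/-! ## §1 Kernel-family algebra: (5.10)/(5.9)/(5.7), `secondMoment`, `m2Tensor` under scaling and finite sums -/

/-- Scaling a kernel: `(c • P) μ ν z = c * P μ ν z`. [folklore] -/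
theorem smul_apply' (c : ℝ) (P : EKer 4) (μ ν : Fin 4) (z : Fin 4 → ℤ) : (c • P) μ ν z = c * P μ ν z := rfl

/-- (5.10)-type decay under scaling. [folklore] -/
theorem decay510_smul {f : (Fin 4 → ℤ) → ℝ} {C δ : ℝ} (h : B12Sec2to5.Decay510 f C δ) (c : ℝ) :
    B12Sec2to5.Decay510 (fun z => c * f z) (|c| * C) δ := fun z => by
  rw [abs_mul, mul_assoc]
  exact mul_le_mul_of_nonneg_left (h z) (abs_nonneg c)

/-- The Ward identity (5.9) is linear: it survives scaling. [folklore] -/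
theorem wardTransversal_smul {P : EKer 4} (h : WardTransversal P) (c : ℝ) : WardTransversal (c • P) := by
  intro ν z
  have := h ν z
  simp only [smul_apply', ← mul_sub, ← Finset.mul_sum, this, mul_zero]

/-- Reflection covariance (5.7) is linear: it survives scaling. [folklore] -/
theorem axisReflectionCovariant_smul {P : EKer 4} (h : AxisReflectionCovariant P) (c : ℝ) :
    AxisReflectionCovariant (c • P) := by
  intro α μ ν z
  simp only [smul_apply', h α μ ν z]
  ring

/-- The (1.22) second moment is linear in the kernel: scaling. [folklore] -/
theorem secondMoment_smul (c : ℝ) (P : EKer 4) (μ ν : Fin 4) : secondMoment (c • P) μ ν = c * secondMoment P μ ν := by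
  unfold secondMoment
  rw [← tsum_mul_left]
  refine tsum_congr fun x => ?_
  rw [smul_apply']
  ring

/-- Summability of the (1.22) summand from `AbsMoment₂`. [folklore] -/
theorem summable_secondMoment_term {f : (Fin 4 → ℤ) → ℝ} (hf : AbsMoment₂ f) (μ ν : Fin 4) :
    Summable fun x : Fin 4 → ℤ => f x * (x μ : ℝ) * (x ν : ℝ) := by
  have h := summable_smul_of_absMoment₂ hf (IsMoment₂.coord2 μ ν)
  refine h.congr fun x => ?_
  rw [zsmul_eq_mul, Int.cast_mul]
  ring

/-- The (1.22) second moment is additive over kernels with absolutely summable second moments. [folklore] -/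
theorem secondMoment_add {P Q : EKer 4} (hP : ∀ c e, AbsMoment₂ (P c e)) (hQ : ∀ c e, AbsMoment₂ (Q c e)) (μ ν : Fin 4) :
    secondMoment (P + Q) μ ν = secondMoment P μ ν + secondMoment Q μ ν := by
  unfold secondMoment
  rw [← (summable_secondMoment_term (hP μ ν) μ ν).tsum_add (summable_secondMoment_term (hQ μ ν) μ ν)]
  refine tsum_congr fun x => ?_
  simp only [Pi.add_apply]
  ring

/-- `AbsMoment₂` is additive. [folklore] -/
theorem absMoment₂_add {f g : (Fin 4 → ℤ) → ℝ} (hf : AbsMoment₂ f) (hg : AbsMoment₂ g) : AbsMoment₂ (f + g) := by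
  unfold AbsMoment₂ at hf hg ⊢
  refine (hf.add hg).of_nonneg_of_le (fun z => by positivity) fun z => ?_
  rw [Pi.add_apply, ← mul_add]
  exact mul_le_mul_of_nonneg_left (abs_add_le _ _) (by positivity)

/-- `AbsMoment₂ 0`. [folklore] -/
theorem absMoment₂_zero : AbsMoment₂ (0 : (Fin 4 → ℤ) → ℝ) := by
  unfold AbsMoment₂; simp [summable_zero]

/-- `AbsMoment₂` under scaling. [folklore] -/
theorem absMoment₂_const_mul {f : (Fin 4 → ℤ) → ℝ} (hf : AbsMoment₂ f) (c : ℝ) : AbsMoment₂ (fun z => c * f z) := by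
  unfold AbsMoment₂ at hf ⊢
  refine (hf.mul_left |c|).congr fun z => ?_
  rw [abs_mul]; ring

/-- Channels of a finite sum of kernels have absolutely summable second moments. [folklore] -/
theorem absMoment₂_kernel_sum {ι : Type*} (s : Finset ι) {T : ι → EKer 4} (h : ∀ i, ∀ c e, AbsMoment₂ (T i c e)) (c e : Fin 4) :
    AbsMoment₂ ((∑ i ∈ s, T i) c e) := by
  classical
  induction s using Finset.induction_on with
  | empty => rw [Finset.sum_empty]; exact absMoment₂_zero
  | insert a s ha ih =>
    rw [Finset.sum_insert ha]
    exact absMoment₂_add (h a c e) ih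

/-- The (1.22) second moment of a finite sum of kernels. [folklore] -/
theorem secondMoment_sum {ι : Type*} (s : Finset ι) {T : ι → EKer 4} (h : ∀ i, ∀ c e, AbsMoment₂ (T i c e)) (μ ν : Fin 4) :
    secondMoment (∑ i ∈ s, T i) μ ν = ∑ i ∈ s, secondMoment (T i) μ ν := by
  classical
  induction s using Finset.induction_on with
  | empty =>
    simp only [Finset.sum_empty]
    unfold secondMoment; simp
  | insert a s ha ih =>
    rw [Finset.sum_insert ha, Finset.sum_insert ha, secondMoment_add (h a) (absMoment₂_kernel_sum s h) μ ν, ih]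

/-- Summability of the `m2Tensor` summand from `AbsMoment₂`. [folklore] -/
theorem summable_m2Tensor_term {f : (Fin 4 → ℤ) → ℝ} (hf : AbsMoment₂ f) (κ lam : Fin 4) :
    Summable fun t : Fin 4 → ℤ => (t κ * t lam) • f t :=
  summable_smul_of_absMoment₂ hf (IsMoment₂.coord2 κ lam)

/-- `m2Tensor` is additive over kernels with absolutely summable second moments. [folklore] -/
theorem m2Tensor_add {P Q : EKer 4} (hP : ∀ c e, AbsMoment₂ (P c e)) (hQ : ∀ c e, AbsMoment₂ (Q c e)) :
    m2Tensor (P + Q) = m2Tensor P + m2Tensor Q := by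
  funext κ lam a b
  simp only [Pi.add_apply]
  unfold m2Tensor
  rw [← (summable_m2Tensor_term (hP a b) κ lam).tsum_add (summable_m2Tensor_term (hQ a b) κ lam)]
  refine tsum_congr fun t => ?_
  rw [Pi.add_apply, Pi.add_apply, Pi.add_apply, smul_add]

/-- `m2Tensor 0 = 0`. [folklore] -/
theorem m2Tensor_zero : m2Tensor (0 : EKer 4) = 0 := by
  funext κ lam a b
  unfold m2Tensor
  simp

/-- `m2Tensor` of a finite sum of kernels. [folklore] -/
theorem m2Tensor_sum {ι : Type*} (s : Finset ι) {T : ι → EKer 4} (h : ∀ i, ∀ c e, AbsMoment₂ (T i c e)) :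
    m2Tensor (∑ i ∈ s, T i) = ∑ i ∈ s, m2Tensor (T i) := by
  classical
  induction s using Finset.induction_on with
  | empty => simp only [Finset.sum_empty, m2Tensor_zero]
  | insert a s ha ih =>
    rw [Finset.sum_insert ha, Finset.sum_insert ha, m2Tensor_add (h a) (absMoment₂_kernel_sum s h), ih]

/-- The (1.22) second moment is insensitive to `z ↦ −z` (`x_μ x_ν` is even). [folklore] -/
theorem secondMoment_flip (P : EKer 4) (μ ν : Fin 4) : secondMoment (fun c e z => P c e (-z)) μ ν = secondMoment P μ ν := by
  unfold secondMoment
  rw [← (Equiv.neg (Fin 4 → ℤ)).tsum_eq (fun x => P μ ν x * (x μ : ℝ) * (x ν : ℝ))]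
  refine tsum_congr fun x => ?_
  simp only [Equiv.neg_apply, Pi.neg_apply, Int.cast_neg]
  ring

/-! ## §2 The witness data -/

/-- The free parameters of the witness: base-point labels, the (1.22) channel, colour parameter `N`, the B5/one-shot averaging parameter `a`,
the label map `k`, the block size `Lc`, and a FREE perturbation sequence `d` (admissible whenever its partial sums are bounded, §3). [folklore] -/
structure Cfg (L : Type*) where
  SL : Finset L
  μ : Fin 4
  ν : Fin 4
  N : ℝ
  a : ℝ
  k : L → Fin 4
  Lc : ℕ
  d : ℕ → ℝ

variable (P : Cfg L)

/-- The PRINT-convention base kernel `Π^ℤ`: pv09's explicit infinite-volume Maxwell kernel on `ℤ⁴` ((5.7)/(5.9)/(5.10) hold; β-moment `2`). [folklore] -/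
def K₀ : EKer 4 := maxwellKernelZ 4

/-- The KERNEL-convention base kernel `z ↦ Π^ℤ(−z)` — the orientation of `hessKer`-type families (RULING (R21)). [folklore] -/
def K₀flip : EKer 4 := fun μ ν z => maxwellKernelZ 4 μ ν (-z)

/-- One-step coefficients: half-increments of the one-shot side plus the free perturbation. [folklore] -/
def coef (j : ℕ) : ℝ :=
  (oneShotSide P.SL P.μ P.ν P.N P.a P.k (P.Lc ^ (j + 1)) - oneShotSide P.SL P.μ P.ν P.N P.a P.k (P.Lc ^ j)) / 2 + P.d j

/-- The one-step kernels of the witness: `T j := coef j • K₀flip` (kernel convention). [folklore] -/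
def Tw (j : ℕ) : EKer 4 := coef P j • K₀flip

/-- The one-shot kernels of the witness: `𝒯 m := Σ_{j<m} T j`. [folklore] -/
def Tsw (m : ℕ) : EKer 4 := ∑ j ∈ range m, Tw P j

/-- The one-loop coefficients of the witness, DEFINED as the (1.22) read-out of the one-step kernels. [folklore] -/
def beta0 (j : ℕ) : ℝ := secondMoment (Tw P j) P.μ P.ν

/-- The history-independent β-family `β_{k+1}(g_0,…,g_k) := β⁰_k`. [folklore] -/
def betaW : HBeta := fun k _ => beta0 P k

/-- Its split with `β¹ := 0`. [folklore] -/
def splitW : B12Beta.OneLoopSplit (betaW P) where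
  β0 := beta0 P
  β1 := fun _ _ => 0
  split := fun k p => by simp [betaW]
  vanish := fun _ _ _ => rfl

/-! ## §3 Every binder of socket v2, at the witness -/

/-- The flips of the one-step kernels are the PRINT-convention multiples `coef j • Π^ℤ`. [folklore] -/
theorem flip_Tw (j : ℕ) : (fun μ ν z => Tw P j μ ν (-z)) = coef P j • K₀ := by
  funext μ ν z
  simp only [Tw, K₀flip, K₀, smul_apply', neg_neg]

/-- (5.10) per step: `Decay510 (T j μ' ν') (|coef j| · 40e²) 1`. [folklore] -/
theorem hdec_w : ∀ j, ∃ C δ : ℝ, 0 < δ ∧ ∀ μ' ν', B12Sec2to5.Decay510 (Tw P j μ' ν') C δ := fun j =>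
  ⟨|coef P j| * (8 * ((4 : ℕ) + 1) * Real.exp (2 * 1)), 1, one_pos, fun μ' ν' =>
    decay510_smul (decay510_flip (decay510_maxwellKernelZ (d := 4) zero_le_one μ' ν')) (coef P j)⟩

/-- (5.9) OF THE FLIPPED kernels, per step (socket binder `hW♭`). [folklore] -/
theorem hW_w : ∀ j, WardTransversal (fun μ ν z => Tw P j μ ν (-z)) := fun j => by
  rw [flip_Tw]; exact wardTransversal_smul wardTransversal_maxwellKernelZ (coef P j)

/-- (5.7) OF THE FLIPPED kernels, per step (socket binder `hR♭`). [folklore] -/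
theorem hR_w : ∀ j, AxisReflectionCovariant (fun μ ν z => Tw P j μ ν (-z)) := fun j => by
  rw [flip_Tw]; exact axisReflectionCovariant_smul axisReflectionCovariant_maxwellKernelZ (coef P j)

/-- The (1.22) read-out binder holds by `rfl`. [folklore] -/
theorem hβ_w : ∀ j, (splitW P).β0 j = secondMoment (Tw P j) P.μ P.ν := fun _ => rfl

/-- The socket's per-step data (hTA, (T0), (T1)) at the witness, through `ScalewiseVectorSeam.scalewiseData_of_printed_flip`. [folklore] -/
theorem data_w : (∀ j c e, AbsMoment₂ (Tw P j c e)) ∧ (∀ j c e, HasSum (Tw P j c e) 0) ∧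
    (∀ j c e (ρ : Fin 4), HasSum (fun t : Fin 4 → ℤ => t ρ • Tw P j c e t) 0) :=
  scalewiseData_of_printed_flip (hdec_w P) (hW_w P) (hR_w P)

/-- `D1Tel` at the witness: the second-moment tensors telescope (each pulled-back tensor IS `m2Tensor (T j)` by
`coarseTensor_minimiser`, and `m2Tensor` is additive). [folklore] -/
theorem htel_w [NeZero P.Lc] : HessianTelescoping P.Lc (Tw P) (Tsw P) := by
  obtain ⟨hTA, hT0, hT1⟩ := data_w P
  intro m hm
  unfold Tsw
  rw [m2Tensor_sum (range m) hTA]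
  refine Finset.sum_congr rfl fun j _ => ?_
  exact coarseTensor_minimiser (N := P.Lc ^ (m - j)) (Tw P j) (hTA j) (hT0 j) (hT1 j)

/-- The (1.22) moment of the one-step kernels: `secondMoment (T j) μ ν = 2 · coef j` (`μ ≠ ν`). [folklore] -/
theorem secondMoment_Tw (hμν : P.μ ≠ P.ν) (j : ℕ) : secondMoment (Tw P j) P.μ P.ν = 2 * coef P j := by
  unfold Tw
  rw [secondMoment_smul]
  unfold K₀flip
  rw [secondMoment_flip (maxwellKernelZ 4), secondMoment_maxwellKernelZ hμν, mul_comm]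

/-- The partial sums of the witness's one-loop coefficients: one-shot side at `Lc^m` minus at `Lc^0`, plus twice the partial sum of `d`. [folklore] -/
theorem sum_beta0 (hμν : P.μ ≠ P.ν) (m : ℕ) :
    ∑ j ∈ range m, beta0 P j =
      (oneShotSide P.SL P.μ P.ν P.N P.a P.k (P.Lc ^ m) - oneShotSide P.SL P.μ P.ν P.N P.a P.k (P.Lc ^ 0))
        + 2 * ∑ j ∈ range m, P.d j := by
  have h : ∀ j ∈ range m, beta0 P j =
      (oneShotSide P.SL P.μ P.ν P.N P.a P.k (P.Lc ^ (j + 1)) - oneShotSide P.SL P.μ P.ν P.N P.a P.k (P.Lc ^ j)) + 2 * P.d j := by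
    intro j _
    unfold beta0
    rw [secondMoment_Tw P hμν]
    unfold coef
    ring
  rw [Finset.sum_congr rfl h, Finset.sum_add_distrib, Finset.sum_range_sub (fun j => oneShotSide P.SL P.μ P.ν P.N P.a P.k (P.Lc ^ j)),
    ← Finset.mul_sum]

/-- `D1Rep` at the witness: with `|Σ_{j<m} d j| ≤ D` for all `m`, the (1.22) moment of the one-shot kernel stays within
`|oneShotSide … 1| + 2D` of the one-shot side, uniformly in `m`. [folklore] -/
theorem hrep_w (hμν : P.μ ≠ P.ν) {D : ℝ} (hd : ∀ m, |∑ j ∈ range m, P.d j| ≤ D) :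
    ∀ m : ℕ, 1 ≤ m → |secondMoment (Tsw P m) P.μ P.ν - oneShotSide P.SL P.μ P.ν P.N P.a P.k (P.Lc ^ m)|
      ≤ |oneShotSide P.SL P.μ P.ν P.N P.a P.k 1| + 2 * D := by
  intro m _
  obtain ⟨hTA, -, -⟩ := data_w P
  unfold Tsw
  rw [secondMoment_sum (range m) hTA]
  have h := sum_beta0 P hμν m
  unfold beta0 at h
  rw [h, pow_zero]
  have e : oneShotSide P.SL P.μ P.ν P.N P.a P.k (P.Lc ^ m) - oneShotSide P.SL P.μ P.ν P.N P.a P.k 1 + 2 * ∑ j ∈ range m, P.d j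
      - oneShotSide P.SL P.μ P.ν P.N P.a P.k (P.Lc ^ m) = 2 * ∑ j ∈ range m, P.d j - oneShotSide P.SL P.μ P.ν P.N P.a P.k 1 := by ring
  rw [e]
  calc |2 * ∑ j ∈ range m, P.d j - oneShotSide P.SL P.μ P.ν P.N P.a P.k 1|
      ≤ |2 * ∑ j ∈ range m, P.d j| + |oneShotSide P.SL P.μ P.ν P.N P.a P.k 1| := abs_sub _ _
    _ ≤ 2 * D + |oneShotSide P.SL P.μ P.ν P.N P.a P.k 1| := by
        rw [abs_mul, abs_two]; exact add_le_add (mul_le_mul_of_nonneg_left (hd m) zero_le_two) le_rfl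
    _ = _ := add_comm _ _

/-- (D4) at the witness: `β¹ = 0`, so `RemainderConst … γ₀ 0`. [folklore] -/
theorem hrem_w (γ₀ : ℝ) : RemainderConst (splitW P) γ₀ 0 := fun _ _ _ => by simp [splitW]

/-- (C) at the witness: each `β_{k+1}` is constant in the history. [folklore] -/
theorem hcont_w (γ₀ : ℝ) : BetaContH γ₀ (betaW P) := fun _ => continuousOn_const

/-- Window data: `M n := n`, `cc := 1`. [folklore] -/
theorem hM_w : ∀ L : ℕ, 2 ≤ L → 1 ≤ (fun n : ℕ => n) L ∧ (L : ℝ) ≤ 1 * (fun n : ℕ => n) L := fun L hL =>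
  ⟨by simp only; omega, by simp⟩

/-- [folklore] -/
theorem hML_w : ∀ L : ℕ, 2 ≤ L → (fun n : ℕ => n) L ≤ L := fun _ _ => le_rfl

/-! ## §4 Socket v2 APPLIED to the witness; non-degeneracy -/

set_option maxHeartbeats 400000 in
/-- **JOINT NON-VACUITY OF THE EXIT-B SOCKET v2.**  `ScalewiseVectorSeam.endpointExistence_of_scalewise_vectorSeam_printed_flip_cont` APPLIED
BY NAME to the explicit witness: every binder other than the two printed Props (h12, h126 — hypotheses by name, as in the wall) is a proof
term of §3; NO upper-bound binder (RULING (R22)); `hW♭`/`hR♭` in the kernel's convention (RULING (R21)).  The B5 parameter `a` of `h12` IS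
the `a` of the one-shot side.  Discharges NOTHING for Bałaban's objects. [folklore] -/
theorem socket_v2_inhabited (ha : 0 < P.a)
    (h12 : B5.Prop12Printed (fam (fun i : ℕ+ × ℕ => ((i.1 : ℕ+) : ℕ)) (fun i => i.1.pos) MvE P.a ha))
    (h126 : B5.Kernel126_127Printed (kfam (fun i : ℕ+ × ℕ => ((i.1 : ℕ+) : ℕ)) MvE))
    (hSL : P.SL.Nonempty) (hμν : P.μ ≠ P.ν) (hN : P.N ≠ 0) [NeZero P.Lc] (hL : 2 ≤ P.Lc)
    {D : ℝ} (hd : ∀ m, |∑ j ∈ range m, P.d j| ≤ D) :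
    EndpointExistence (modelOf (betaW P)) :=
  have h1 : (1 : ℕ) ≤ P.Lc := by omega
  endpointExistence_of_scalewise_vectorSeam_printed_flip_cont (L := L) P.a ha h12 h126 hSL P.k (Cn := modelOf (betaW P)) (β := betaW P)
    (modelOf_forwardGenerated (betaW P)) (splitW P) hμν hN (Lc := P.Lc) hL (Tw P) (Tsw P) (hdec_w P) (hW_w P) (hR_w P) (hβ_w P) (htel_w P)
    (U := |oneShotSide P.SL P.μ P.ν P.N P.a P.k 1| + 2 * D) (cc := 1) (M := fun n => n) le_rfl hM_w hML_w (hrep_w P hμν hd)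
    (γ₀ := 1) (rr := 0) one_pos (hrem_w P 1) (WallWitness.stepBal_nonneg P.N h1) (hcont_w P 1)

/-- NON-DEGENERACY: the (1.22) moment of the step-0 kernel equals the one-shot increment plus `2·d 0`, `d 0` FREE: the socket does NOT pin `β⁰`
(in particular not to `0`, the value RULING (R21) located for an unflipped instantiation). [folklore] -/
theorem step0_moment_free (hμν : P.μ ≠ P.ν) :
    secondMoment (Tw P 0) P.μ P.ν =
      (oneShotSide P.SL P.μ P.ν P.N P.a P.k (P.Lc ^ 1) - oneShotSide P.SL P.μ P.ν P.N P.a P.k (P.Lc ^ 0)) + 2 * P.d 0 := by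
  rw [secondMoment_Tw P hμν]; unfold coef; ring

/-- The spike perturbation `d := (δ, 0, 0, …)` is admissible with `D := |δ|`. [folklore] -/
theorem spike_bounded (δ : ℝ) : ∀ m, |∑ j ∈ range m, (fun j => if j = 0 then δ else (0 : ℝ)) j| ≤ |δ| := by
  intro m
  rcases Nat.eq_zero_or_pos m with h0 | h0
  · subst h0; simp
  · rw [Finset.sum_ite_eq' (range m) 0 (fun _ => δ)]
    simp [Finset.mem_range.mpr h0]

/-- … so for EVERY admissible parameter record and every real `δ` the socket is inhabited by a witness whose step-0 kernel has (1.22) moment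
`(one-shot increment) + 2δ`. [folklore] -/
theorem socket_v2_inhabited_spike (SL : Finset L) (μ ν : Fin 4) (N a : ℝ) (k : L → Fin 4) (Lc : ℕ) (δ : ℝ) (ha : 0 < a)
    (h12 : B5.Prop12Printed (fam (fun i : ℕ+ × ℕ => ((i.1 : ℕ+) : ℕ)) (fun i => i.1.pos) MvE a ha))
    (h126 : B5.Kernel126_127Printed (kfam (fun i : ℕ+ × ℕ => ((i.1 : ℕ+) : ℕ)) MvE))
    (hSL : SL.Nonempty) (hμν : μ ≠ ν) (hN : N ≠ 0) [NeZero Lc] (hL : 2 ≤ Lc) :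
    let P : Cfg L := ⟨SL, μ, ν, N, a, k, Lc, fun j => if j = 0 then δ else 0⟩
    EndpointExistence (modelOf (betaW P)) ∧
      secondMoment (Tw P 0) μ ν = (oneShotSide SL μ ν N a k (Lc ^ 1) - oneShotSide SL μ ν N a k (Lc ^ 0)) + 2 * δ := by
  intro P
  exact ⟨socket_v2_inhabited P ha h12 h126 hSL hμν hN hL (spike_bounded δ), by rw [step0_moment_free P hμν]; simp [P]⟩

end Literature.MathematicalPhysics.QuantumFieldTheory.Balaban1983to89.Beta.ScalewiseWitness
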